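import Mathlib
import Summits.ValiantsHypothesis.ValiantsHypothesis.Theses.ImmanantSlice

/-!
# Route ImmanantSlice — `TargetToTwoClass` (item stmt-ValiantsHypothesis-4216)

Cuspidal rigidity implies its two-class form: `CuspidalRigidity → TwoClassRigidity`.

This is pure sign bookkeeping. Given the data `k, n₀` (and, for each `n ≥ n₀`, the scalar `c`) of
cuspidal rigidity for a VP class-function family `χ`, an `n`-cycle `σ` (cycle type `{n}`) and a
permutation `τ` of cycle type `{a, n - a}` with `k < a`, `k < n - a` are both fixed-point-free
(their supports have `n` elements) with all cycles longer than `k`, so `χ n σ = c • sgn σ` and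
`χ n τ = c • sgn τ`; finally `sgn σ = (-1)^(n+1)` and `sgn τ = (-1)^(n+2)`
(`Equiv.Perm.sign_of_cycleType`), whence `χ n σ = -χ n τ`.

Sources: Bürgisser 2000 (sign of a cycle type); Mathlib `Equiv.Perm.sign_of_cycleType`,
`Equiv.Perm.sum_cycleType`.
-/

-- `Summit.<Summit>.<Problem>` repeats `ValiantsHypothesis` by the tree's layout convention (D-0017).
set_option linter.dupNamespace false

namespace Summit.ValiantsHypothesis.ValiantsHypothesis.Theorems

open Equiv

/-- A permutation of `Fin n` whose cycle type sums to `n` moves every point. -/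
theorem immanantSlice_fixedPointFree_of_sum_cycleType {n : ℕ} (σ : Perm (Fin n))
    (h : σ.cycleType.sum = n) : ∀ i, σ i ≠ i := by
  intro i
  have hsupp : σ.support = Finset.univ := by
    apply Finset.eq_univ_of_card
    rw [← Equiv.Perm.sum_cycleType, h, Fintype.card_fin]
  have hi : i ∈ σ.support := hsupp ▸ Finset.mem_univ i
  exact Equiv.Perm.mem_support.mp hi

/-- The sign of a permutation of `Fin n` with cycle type `{n}` (an `n`-cycle), cast to `ℂ`,
is `(-1)^(n+1)`. -/
theorem immanantSlice_sign_of_cycleType_singleton {n : ℕ} (σ : Perm (Fin n))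
    (hσ : σ.cycleType = {n}) : ((Equiv.Perm.sign σ : ℤ) : ℂ) = (-1 : ℂ) ^ (n + 1) := by
  rw [Equiv.Perm.sign_of_cycleType, hσ, Multiset.sum_singleton, Multiset.card_singleton]
  push_cast
  rfl

/-- The sign of a permutation of `Fin n` with cycle type `{a, n - a}` where `a < n`
(a product of two disjoint long cycles), cast to `ℂ`, is `(-1)^(n+2)`. -/
theorem immanantSlice_sign_of_cycleType_pair {n a : ℕ} (τ : Perm (Fin n)) (han : a + (n - a) = n)
    (hτ : τ.cycleType = {a, n - a}) : ((Equiv.Perm.sign τ : ℤ) : ℂ) = (-1 : ℂ) ^ (n + 2) := by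
  rw [Equiv.Perm.sign_of_cycleType, hτ, Multiset.insert_eq_cons, Multiset.sum_cons,
    Multiset.sum_singleton, Multiset.card_cons, Multiset.card_singleton, han]
  push_cast
  rfl

/-- **TargetToTwoClass** (route ImmanantSlice, item stmt-ValiantsHypothesis-4216): cuspidal
rigidity `CuspidalRigidity` implies the two-class form `TwoClassRigidity` — with the same `k, n₀`;
the `n`-cycle class and the class of type `(a, n - a)` both lie in `Π_k(n)` when `k < a`,
`k < n - a`, and their signs are opposite. -/
theorem targetToTwoClass_proof :
    Summit.ValiantsHypothesis.ValiantsHypothesis.Theses.ImmanantSlice.TargetToTwoClass := by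
  unfold Summit.ValiantsHypothesis.ValiantsHypothesis.Theses.ImmanantSlice.TargetToTwoClass
    Summit.ValiantsHypothesis.ValiantsHypothesis.Theses.ImmanantSlice.CuspidalRigidity
    Summit.ValiantsHypothesis.ValiantsHypothesis.Theses.ImmanantSlice.TwoClassRigidity
  intro hCR χ hclass hVP
  obtain ⟨k, n₀, hk⟩ := hCR χ hclass hVP
  refine ⟨k, n₀, fun n hn a ha hna σ τ hσ hτ => ?_⟩
  obtain ⟨c, hc⟩ := hk n hn
  have han : a + (n - a) = n := by omega
  have hσfree : ∀ i, σ i ≠ i :=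
    immanantSlice_fixedPointFree_of_sum_cycleType σ (by rw [hσ, Multiset.sum_singleton])
  have hτfree : ∀ i, τ i ≠ i :=
    immanantSlice_fixedPointFree_of_sum_cycleType τ (by
      rw [hτ, Multiset.insert_eq_cons, Multiset.sum_cons, Multiset.sum_singleton]; exact han)
  have hσlong : ∀ m ∈ σ.cycleType, k < m := by
    intro m hm
    rw [hσ, Multiset.mem_singleton] at hm
    omega
  have hτlong : ∀ m ∈ τ.cycleType, k < m := by
    intro m hm
    rw [hτ, Multiset.insert_eq_cons, Multiset.mem_cons, Multiset.mem_singleton] at hm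
    rcases hm with rfl | rfl <;> omega
  rw [hc σ hσfree hσlong, hc τ hτfree hτlong, immanantSlice_sign_of_cycleType_singleton σ hσ,
    immanantSlice_sign_of_cycleType_pair τ han hτ]
  ring

end Summit.ValiantsHypothesis.ValiantsHypothesis.Theorems
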